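import Literature.NumberTheory.DiophantineGeometry.GenEllNorthcott
import Literature.NumberTheory.Transcendental.QuadraticRelationsLogarithmsMahlerWeil
import Mathlib.NumberTheory.MahlerMeasure
import Mathlib.RingTheory.Polynomial.ScaleRoots
import Mathlib.Data.Nat.Choose.Bounds
import HarnessLib

/-!
# [GenEll] Prop. 1.4 (iv) for the projective line = uniform Northcott: PROOF of the named fact
# `northcott_UPle`

Proof-only companion of `GenEllNorthcott.lean` (abc-iut campaign S, typed by seat abc-iut-S4): we
DISCHARGE the named fact

> `northcott_UPle : ∀ (d : ℕ) (C : ℝ), HasFinitelyManyPoints {P | P ∈ UPle d ∧ P.ht ≤ C}`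

("There are only finitely many algebraic numbers of bounded degree and bounded height",
[cite: BombieriGubler2006, Thm 1.6.8]; S. Mochizuki, *Arithmetic elliptic curves in general
position*, Prop. 1.4 (iv) for `(ℙ¹_ℚ, ω_P(C))`), i.e. `theorem northcott_UPle_holds : northcott_UPle`.

Mathlib proves Northcott one number field at a time (`NumberField.finite_setOf_logHeight₁_le`); the
uniform-in-the-field version for points of degree `≤ d` is proved here, from Mathlib ingredients only:

* `NumberField.exists_nat_le_mulHeight₁`: every `x ∈ F` has a "denominator" `N ∈ ℕ`, `N ≠ 0`, with
  `N ≤ H_F(x)` and `N·x` an algebraic integer;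
* every archimedean absolute value is bounded by the height, `‖φ x‖ ≤ H_F(x)` for `φ : F →+* ℂ`
  (`norm_embedding_le_mulHeight₁`, from `NumberField.mulHeight₁_eq`);
* `NumberField.Embeddings.coeff_bdd_of_norm_le`: the coefficients of `minpoly ℚ y` are bounded in terms
  of a bound for the conjugates of `y` and of `[F:ℚ]`; for `y = N·x` integral they are integers
  (`minpoly.isIntegrallyClosed_eq_field_fractions'`);
* `minpoly ℚ x` is recovered from `minpoly ℚ (N·x)` by rescaling the roots (`Polynomial.scaleRoots`
  by `N⁻¹`: monic, vanishes at `x`, degree `≤ [F:ℚ] = deg minpoly ℚ x` because the point is presented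
  over its minimal field `F = ℚ(x)`).

Hence for `P = (F, x) ∈ U_P(Q̄)^{≤d}` with `ht(P) = [F:ℚ]⁻¹ h_F(x) ≤ C` we get `H_F(x) ≤ H := exp(d·max(C,0))`,
`N ≤ H`, `‖φ(N x)‖ ≤ H²`, and the minimal polynomial of `P` lies in the image of the FINITE set
`{1,…,⌊H⌋} × {g ∈ ℚ[X] : deg g ≤ d, coefficients ∈ ℤ ∩ [−B, B]}`, `B = ⌈max(H²,1)^d · 2^d⌉`.

No new definitions; `GenEllNorthcott.lean` is not edited.

## Second route (seat abc-iut-L3-t12, p404827): `ht(P) = log M(Q) / deg Q`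

The file also carries abc-iut-L3-t12's independent proof route (landed as p404827 and restored here
verbatim after an accidental whole-file overwrite by p404964; the two seats proved the same named fact
concurrently): for an irreducible integer polynomial `Q` of positive degree with `Q(x) = 0`,
`minpoly_ℚ(x) = Q/lead(Q)` and — Bombieri–Gubler Prop. 1.6.6 in the tree's form
`RoyWaldschmidt1997.MahlerWeil.weilHeight₁_root_eq` (Gauss's lemma + product formula), transported
from `ℚ(φ x) ⊂ ℂ` to the abstract field `F` by `NumberField.logHeight₁_map_ringHom` —
`ht(P) = log M(Q) / deg Q` (`NFPoint.ht_eq_log_mahlerMeasure_div`, `M` = Mahler measure), whence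
Northcott also follows from Mathlib's `Polynomial.finite_mahlerMeasure_le`
(`northcott_UPle_holds'`).
-/

noncomputable section

open NumberField Polynomial Height

namespace Literature.NumberTheory.DiophantineGeometry.GenEll

/-- Every archimedean absolute value of an element of a number field is bounded by its multiplicative
height: `‖φ x‖ ≤ H_K(x) = ∏_v max(1, ‖x‖_v)^{n_v}` for every embedding `φ : K →+* ℂ` (all factors of the
height are `≥ 1`, and `‖φ x‖` is one of them). [cite: BombieriGubler2006, Thm 1.6.8] -/
theorem norm_embedding_le_mulHeight₁ {K : Type*} [Field K] [NumberField K] (φ : K →+* ℂ) (x : K) :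
    ‖φ x‖ ≤ mulHeight₁ x := by
  classical
  rw [NumberField.mulHeight₁_eq, ← NumberField.InfinitePlace.apply φ x]
  set w : NumberField.InfinitePlace K := NumberField.InfinitePlace.mk φ with hw
  have h1 : w x ≤ max (w x) 1 ^ w.mult :=
    (le_max_left _ _).trans (le_self_pow₀ (le_max_right _ _) NumberField.InfinitePlace.mult_ne_zero)
  have h2 : max (w x) 1 ^ w.mult ≤ ∏ v : NumberField.InfinitePlace K, max (v x) 1 ^ v.mult := by
    have hf0 : ∀ v ∈ (Finset.univ : Finset (NumberField.InfinitePlace K)),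
        (0 : ℝ) ≤ (if v = w then max (w x) 1 ^ w.mult else 1) := by
      intro v _
      split_ifs
      · exact pow_nonneg (zero_le_one.trans (le_max_right _ _)) _
      · exact zero_le_one
    have hfg : ∀ v ∈ (Finset.univ : Finset (NumberField.InfinitePlace K)),
        (if v = w then max (w x) 1 ^ w.mult else 1) ≤ max (v x) 1 ^ v.mult := by
      intro v _
      split_ifs with hv
      · rw [hv]
      · exact one_le_pow₀ (le_max_right _ _)
    have h := Finset.prod_le_prod hf0 hfg
    simpa using h
  have h3 : (1 : ℝ) ≤ ∏ᶠ v : NumberField.FinitePlace K, max (v x) 1 :=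
    one_le_finprod fun _ => le_max_right _ _
  have h4 : (0 : ℝ) ≤ ∏ v : NumberField.InfinitePlace K, max (v x) 1 ^ v.mult :=
    Finset.prod_nonneg fun v _ => pow_nonneg (zero_le_one.trans (le_max_right _ _)) _
  calc w x ≤ max (w x) 1 ^ w.mult := h1
    _ ≤ ∏ v : NumberField.InfinitePlace K, max (v x) 1 ^ v.mult := h2
    _ ≤ (∏ v : NumberField.InfinitePlace K, max (v x) 1 ^ v.mult) *
          ∏ᶠ v : NumberField.FinitePlace K, max (v x) 1 := le_mul_of_one_le_right h4 h3

/-- Polynomials over `ℚ` of degree `≤ d` all of whose coefficients lie in a fixed finite set form a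
finite set (the coefficient vector `(a_0, …, a_d)` determines the polynomial); the counting step of
Northcott's theorem. [cite: BombieriGubler2006, Thm 1.6.8] -/
theorem finite_setOf_natDegree_le_of_coeff_mem {U : Set ℚ} (hU : U.Finite) (d : ℕ) :
    {g : ℚ[X] | g.natDegree ≤ d ∧ ∀ i, g.coeff i ∈ U}.Finite := by
  let π : ℚ[X] → Fin (d + 1) → ℚ := fun f i => f.coeff i
  refine ((Set.Finite.pi fun _ => hU).subset <| ?_).of_finite_image (?_ : Set.InjOn π _)
  · exact Set.image_subset_iff.2 fun f hf i _ => hf.2 i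
  · refine fun f hf g hg hfg => (ext_iff_natDegree_le hf.1 hg.1).2 fun i hi => ?_
    exact id congr_fun hfg ⟨i, Nat.lt_succ_of_le hi⟩

/-- **[GenEll] Prop. 1.4 (iv) for `(ℙ¹_ℚ, ω_P(C) ≅ 𝒪(1))` = uniform Northcott's theorem** — the named
fact `northcott_UPle` HOLDS: for every `d : ℕ` and `C : ℝ`, the points `P = (F, x)` of
`U_P(Q̄)^{≤ d}` (presented over their minimal field `F = ℚ(x)`, `[F:ℚ] ≤ d`) with
`ht(P) = [F:ℚ]⁻¹ · h_F(x) ≤ C` have only finitely many minimal polynomials over `ℚ` ("There are only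
finitely many algebraic numbers of bounded degree and bounded height").
[cite: BombieriGubler2006, Thm 1.6.8] -/
theorem northcott_UPle_holds : northcott_UPle := by
  intro d C
  classical
  -- the uniform constants
  obtain ⟨H, hH⟩ : ∃ H : ℝ, H = Real.exp (d * max C 0) := ⟨_, rfl⟩
  have hH0 : 0 < H := hH ▸ Real.exp_pos _
  have hH1 : 1 ≤ H := hH ▸ Real.one_le_exp (by positivity)
  obtain ⟨B, hB⟩ : ∃ B : ℕ, B = ⌈max (H * H) 1 ^ d * (2 : ℝ) ^ d⌉₊ := ⟨_, rfl⟩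
  have hBR : max (H * H) 1 ^ d * (2 : ℝ) ^ d ≤ B := hB ▸ Nat.le_ceil _
  have hfin : ((fun p : ℕ × ℚ[X] => p.2.scaleRoots ((p.1 : ℚ)⁻¹)) ''
      (Set.Icc 1 ⌊H⌋₊ ×ˢ {g : ℚ[X] | g.natDegree ≤ d ∧
        ∀ i, g.coeff i ∈ ((↑) : ℤ → ℚ) '' Set.Icc (-(B : ℤ)) B})).Finite :=
    ((Set.finite_Icc _ _).prod
      (finite_setOf_natDegree_le_of_coeff_mem ((Set.finite_Icc _ _).image _) d)).image _
  refine hfin.subset ?_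
  rintro _ ⟨P, ⟨⟨⟨hInU, hmin⟩, hdeg⟩, hPC⟩, rfl⟩
  -- `P = (F, x)`, `F = ℚ(x)`, `n = [F:ℚ] ≤ d`, `h_F(x) = n · ht P ≤ d · max C 0`
  have hn : Module.finrank ℚ P.F ≤ d := hdeg
  have hdegR : (0 : ℝ) < P.degree := Nat.cast_pos.mpr P.degree_pos
  have hPC' : (P.degree : ℝ)⁻¹ * logHeight₁ P.x ≤ C := hPC
  have hlog : logHeight₁ P.x ≤ d * max C 0 := by
    have h1 : logHeight₁ P.x = P.degree * ((P.degree : ℝ)⁻¹ * logHeight₁ P.x) := by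
      rw [mul_inv_cancel_left₀ hdegR.ne']
    rw [h1]
    have hdegd : (P.degree : ℝ) ≤ d := by exact_mod_cast hdeg
    calc (P.degree : ℝ) * ((P.degree : ℝ)⁻¹ * logHeight₁ P.x)
        ≤ P.degree * max C 0 :=
          mul_le_mul_of_nonneg_left (hPC'.trans (le_max_left _ _)) hdegR.le
      _ ≤ d * max C 0 := mul_le_mul_of_nonneg_right hdegd (le_max_right _ _)
  have hmH : mulHeight₁ P.x ≤ H := by
    have h1 : Real.exp (logHeight₁ P.x) = mulHeight₁ P.x := by
      rw [logHeight₁_eq_log_mulHeight₁, Real.exp_log (mulHeight₁_pos _)]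
    rw [← h1, hH]
    exact Real.exp_le_exp.mpr hlog
  -- the denominator `N ≤ H_F(x) ≤ H`, `N · x` integral
  obtain ⟨N, hN0, hNle, hNint⟩ := NumberField.exists_nat_le_mulHeight₁ P.x
  have hNH : (N : ℝ) ≤ H := hNle.trans hmH
  have hN1 : 1 ≤ N := Nat.one_le_iff_ne_zero.mpr hN0
  have hNmax : N ≤ ⌊H⌋₊ := Nat.le_floor hNH
  have hN' : (N : P.F) ≠ 0 := Nat.cast_ne_zero.mpr hN0
  obtain ⟨y, hy⟩ : ∃ y : P.F, y = (N : P.F) * P.x := ⟨_, rfl⟩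
  have hyint : IsIntegral ℤ y := hy ▸ hNint
  -- all conjugates of `y = N x` are bounded by `H²`
  have hφy : ∀ φ : P.F →+* ℂ, ‖φ y‖ ≤ H * H := fun φ => by
    rw [hy, map_mul, map_natCast, norm_mul, Complex.norm_natCast]
    exact mul_le_mul hNH ((norm_embedding_le_mulHeight₁ φ P.x).trans hmH) (norm_nonneg _) hH0.le
  -- hence the (integer) coefficients of `minpoly ℚ y` are bounded by `B`
  have hcoef : ∀ i, ‖(minpoly ℚ y).coeff i‖ ≤ (B : ℝ) := fun i => by
    have h := NumberField.Embeddings.coeff_bdd_of_norm_le (A := ℂ) hφy i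
    refine h.trans (le_trans ?_ hBR)
    refine mul_le_mul (pow_le_pow_right₀ (le_max_right _ _) hn) ?_ (Nat.cast_nonneg _)
      (pow_nonneg (zero_le_one.trans (le_max_right _ _)) _)
    calc ((Module.finrank ℚ P.F).choose (Module.finrank ℚ P.F / 2) : ℝ)
        ≤ (2 : ℝ) ^ Module.finrank ℚ P.F := by exact_mod_cast Nat.choose_le_two_pow _ _
      _ ≤ 2 ^ d := pow_le_pow_right₀ one_le_two hn
  have hmap : minpoly ℚ y = (minpoly ℤ y).map (algebraMap ℤ ℚ) :=
    minpoly.isIntegrallyClosed_eq_field_fractions' ℚ hyint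
  have hgcoef : ∀ i, (minpoly ℚ y).coeff i ∈ ((↑) : ℤ → ℚ) '' Set.Icc (-(B : ℤ)) B := fun i => by
    have hci : (minpoly ℚ y).coeff i = (((minpoly ℤ y).coeff i : ℤ) : ℚ) := by
      rw [hmap, coeff_map, eq_intCast]
    have habs : |(((minpoly ℤ y).coeff i : ℤ) : ℝ)| ≤ B := by
      have h := hcoef i
      rwa [hci, Int.norm_cast_rat, Int.norm_eq_abs] at h
    refine ⟨(minpoly ℤ y).coeff i, ⟨?_, ?_⟩, hci.symm⟩
    · have h := (abs_le.mp habs).1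
      exact_mod_cast h
    · have h := (abs_le.mp habs).2
      exact_mod_cast h
  have hgdeg : (minpoly ℚ y).natDegree ≤ d := (minpoly.natDegree_le y).trans hn
  -- reconstruct `minpoly ℚ x` from `minpoly ℚ (N x)` by rescaling the roots by `N⁻¹`
  have hyx : algebraMap ℚ P.F ((N : ℚ)⁻¹) * y = P.x := by
    rw [map_inv₀, map_natCast, hy, inv_mul_cancel_left₀ hN']
  have hroot : aeval P.x ((minpoly ℚ y).scaleRoots ((N : ℚ)⁻¹)) = 0 := by
    have h := scaleRoots_aeval_eq_zero (A := P.F) (r := ((N : ℚ)⁻¹)) (minpoly.aeval ℚ y)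
    rwa [hyx] at h
  have hfmonic : ((minpoly ℚ y).scaleRoots ((N : ℚ)⁻¹)).Monic :=
    (monic_scaleRoots_iff _).2 (minpoly.monic (Algebra.IsIntegral.isIntegral y))
  have hdvd : minpoly ℚ P.x ∣ (minpoly ℚ y).scaleRoots ((N : ℚ)⁻¹) := minpoly.dvd ℚ P.x hroot
  have hdegle : ((minpoly ℚ y).scaleRoots ((N : ℚ)⁻¹)).natDegree ≤ (minpoly ℚ P.x).natDegree := by
    have h2 : (minpoly ℚ P.x).natDegree = P.degree := NFPoint.natDegree_mpoly P hmin
    rw [natDegree_scaleRoots, h2]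
    exact minpoly.natDegree_le y
  have hrecon : (minpoly ℚ y).scaleRoots ((N : ℚ)⁻¹) = minpoly ℚ P.x :=
    eq_of_monic_of_dvd_of_natDegree_le (minpoly.monic (Algebra.IsIntegral.isIntegral P.x))
      hfmonic hdvd hdegle
  exact ⟨(N, minpoly ℚ y), ⟨⟨hN1, hNmax⟩, hgdeg, hgcoef⟩, hrecon⟩

/-! ## Second route (abc-iut-L3-t12, p404827 restored): the height as a Mahler measure -/

open Literature.NumberTheory.Transcendental
open Literature.NumberTheory.Transcendental.RoyWaldschmidt1997
open scoped IntermediateField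

namespace NFPoint

/-- Every element of a number field is a root of an irreducible integer polynomial of positive degree
(an irreducible factor of a non-zero annihilating integer polynomial).
-- proof adapted from `Literature/NumberTheory/Transcendental/PiAlgebraicApproximationMeasure.lean`
-- (`NesterenkoWaldschmidt1996.exists_irreducible_int_aeval_eq_zero`, stated there for `ℂ`).
[folklore] -/
private theorem exists_irreducible_int_aeval_eq_zero (P : NFPoint) :
    ∃ Q : ℤ[X], Irreducible Q ∧ 0 < Q.natDegree ∧ aeval P.x Q = 0 := by
  have hz : IsAlgebraic ℚ P.x := Algebra.IsAlgebraic.isAlgebraic P.x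
  have hzZ : IsAlgebraic ℤ P.x := (IsFractionRing.isAlgebraic_iff ℤ ℚ P.F).mpr hz
  obtain ⟨p, hp0, hpz⟩ := hzZ
  -- some irreducible factor of `p` vanishes at `x`
  suffices H : ∀ R : ℤ[X], R ≠ 0 → aeval P.x R = 0 →
      ∃ Q : ℤ[X], Irreducible Q ∧ 0 < Q.natDegree ∧ aeval P.x Q = 0 from H p hp0 hpz
  intro R
  induction R using WfDvdMonoid.induction_on_irreducible with
  | zero => intro h; exact absurd rfl h
  | unit u hu =>
    intro _ hu0
    obtain ⟨r, hr, rfl⟩ := Polynomial.isUnit_iff.mp hu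
    rw [aeval_C, algebraMap_int_eq, eq_intCast, Int.cast_eq_zero] at hu0
    rcases Int.isUnit_iff.mp hr with h | h <;> simp [h] at hu0
  | mul a i ha hi IH =>
    intro _ h0
    rw [map_mul, mul_eq_zero] at h0
    rcases h0 with h0 | h0
    · refine ⟨i, hi, ?_, h0⟩
      by_contra hdeg
      push Not at hdeg
      have hdeg0 : i.natDegree = 0 := by omega
      have hc : i.coeff 0 ≠ 0 := by
        intro h
        apply hi.ne_zero
        rw [eq_C_of_natDegree_eq_zero hdeg0, h, C_0]
      rw [eq_C_of_natDegree_eq_zero hdeg0, aeval_C, algebraMap_int_eq, eq_intCast,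
        Int.cast_eq_zero] at h0
      exact hc h0
    · exact IH ha h0

/-- The minimal polynomial over `ℚ` of (the coordinate of) a presented point is `Q / lead(Q)` for any
irreducible integer polynomial `Q` of positive degree vanishing at it (Gauss's lemma: a primitive
integer polynomial irreducible over `ℤ` is irreducible over `ℚ`). [folklore] -/
private theorem mpoly_eq_of_irreducible (P : NFPoint) {Q : ℤ[X]} (hQ : Irreducible Q) (hd : 0 < Q.natDegree)
    (hx : aeval P.x Q = 0) :
    P.mpoly = Q.map (Int.castRingHom ℚ) * C ((Q.map (Int.castRingHom ℚ)).leadingCoeff)⁻¹ := by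
  have hprim : Q.IsPrimitive := hQ.isPrimitive (by omega)
  set p : ℚ[X] := Q.map (Int.castRingHom ℚ) with hp
  have hpirr : Irreducible p := (hprim.irreducible_iff_irreducible_map_fraction_map (K := ℚ)).mp hQ
  have hp0 : p ≠ 0 := hpirr.ne_zero
  have haeval : aeval P.x p = aeval P.x Q := by
    rw [hp]
    exact aeval_map_algebraMap ℚ P.x Q
  unfold mpoly
  symm
  refine minpoly.eq_of_irreducible_of_monic (irreducible_mul_leadingCoeff_inv.mpr hpirr) ?_
    (monic_mul_leadingCoeff_inv hp0)
  rw [map_mul, haeval, hx, zero_mul]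

/-- The degree of an irreducible integer polynomial vanishing at a presented point `(F, x)` is the
degree of `x` over `ℚ`, hence at most `[F:ℚ]`. [folklore] -/
private theorem natDegree_le_degree (P : NFPoint) {Q : ℤ[X]} (hQ : Irreducible Q) (hd : 0 < Q.natDegree)
    (hx : aeval P.x Q = 0) : Q.natDegree ≤ P.degree := by
  have hQ0 : Q.map (Int.castRingHom ℚ) ≠ 0 :=
    (Polynomial.map_ne_zero_iff (Int.castRingHom ℚ).injective_int).mpr hQ.ne_zero
  have hlc : ((Q.map (Int.castRingHom ℚ)).leadingCoeff)⁻¹ ≠ 0 :=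
    inv_ne_zero (leadingCoeff_ne_zero.mpr hQ0)
  have h1 : P.mpoly.natDegree = Q.natDegree := by
    rw [P.mpoly_eq_of_irreducible hQ hd hx, natDegree_mul_C hlc,
      natDegree_map_eq_of_injective (Int.castRingHom ℚ).injective_int]
  rw [← h1]
  exact minpoly.natDegree_le P.x

/-- **`ht(P) = log M(Q) / deg Q`**: the normalised Weil height `[F:ℚ]⁻¹ h_F(x)` of a presented point
`(F, x)` is the logarithm of the Mahler measure of any irreducible integer polynomial `Q` vanishing at
`x`, divided by its degree (Bombieri–Gubler Prop. 1.6.6; here transported from the tree's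
`RoyWaldschmidt1997.MahlerWeil.weilHeight₁_root_eq` for `ℚ(φ x) ⊂ ℂ`, `φ : F → ℂ` an embedding, to
the abstract number field `F` by the field-independence of the absolute height,
`NumberField.logHeight₁_map_ringHom`). [cite: BombieriGubler2006, Prop 1.6.6] -/
theorem ht_eq_log_mahlerMeasure_div (P : NFPoint) {Q : ℤ[X]} (hQ : Irreducible Q)
    (hd : 0 < Q.natDegree) (hx : aeval P.x Q = 0) :
    P.ht = Real.log (Q.map (Int.castRingHom ℂ)).mahlerMeasure / Q.natDegree := by
  classical
  -- an embedding `φ : F → ℂ`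
  have hcard : 0 < Fintype.card (P.F →+* ℂ) := by
    rw [NumberField.Embeddings.card P.F ℂ]
    exact Module.finrank_pos
  obtain ⟨φ⟩ := Fintype.card_pos_iff.mp hcard
  set φ' : P.F →ₐ[ℚ] ℂ := φ.toRatAlgHom with hφ'
  have hφ'x : φ' P.x = φ P.x := rfl
  set α : ℂ := φ P.x with hα
  -- `α` is a root of `Q`, integral over `ℚ`
  have hαQ : aeval α Q = 0 := by
    rw [hα, show φ P.x = φ.toIntAlgHom P.x from rfl, aeval_algHom_apply, hx, map_zero]
  have hαint : IsIntegral ℚ α := by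
    rw [← hφ'x]
    exact (Algebra.IsIntegral.isIntegral (R := ℚ) P.x).map φ'
  -- the number field `ℚ(α) ⊂ ℂ`
  haveI : FiniteDimensional ℚ ℚ⟮α⟯ := IntermediateField.adjoin.finiteDimensional hαint
  haveI : NumberField ℚ⟮α⟯ := numberField_of_intermediateField ℚ⟮α⟯
  have hαF₀ : α ∈ ℚ⟮α⟯ := IntermediateField.mem_adjoin_simple_self ℚ α
  -- Bombieri–Gubler 1.6.6 in `ℚ(α)`
  have h1 := MahlerWeil.weilHeight₁_root_eq Q hQ hd hαQ ℚ⟮α⟯ hαF₀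
  rw [weilHeight₁_single_eq ℚ⟮α⟯ hαF₀] at h1
  -- a ring homomorphism `g : ℚ(α) → F` with `g(α) = x`
  set pb := IntermediateField.adjoin.powerBasis hαint with hpb
  have hgen : pb.gen = (⟨α, hαF₀⟩ : ℚ⟮α⟯) := by
    rw [hpb, IntermediateField.adjoin.powerBasis_gen]
    rfl
  have hmin : minpoly ℚ pb.gen = minpoly ℚ P.x := by
    have e1 : minpoly ℚ pb.gen = minpoly ℚ α := by
      rw [hpb, IntermediateField.adjoin.powerBasis_gen]
      exact IntermediateField.minpoly_gen ℚ α
    rw [e1, ← hφ'x]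
    exact minpoly.algHom_eq φ' φ.injective P.x
  have hroot : aeval P.x (minpoly ℚ pb.gen) = 0 := by
    rw [hmin]
    exact minpoly.aeval ℚ P.x
  set g : ℚ⟮α⟯ →ₐ[ℚ] P.F := pb.lift P.x hroot with hg
  have hgx : g pb.gen = P.x := pb.lift_gen P.x hroot
  -- field-independence of the absolute height along `g`
  have h2 := NumberField.logHeight₁_map_ringHom g.toRingHom pb.gen
  rw [AlgHom.toRingHom_eq_coe, AlgHom.coe_toRingHom, hgx, hgen] at h2
  -- assemble
  have hF0 : (0 : ℝ) < Module.finrank ℚ ℚ⟮α⟯ := by exact_mod_cast Module.finrank_pos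
  have hF : (0 : ℝ) < Module.finrank ℚ P.F := by exact_mod_cast Module.finrank_pos
  unfold ht degree
  rw [← h1, inv_mul_eq_div, div_eq_div_iff hF.ne' hF0.ne']
  linear_combination h2

end NFPoint

/-- **[GenEll] Prop. 1.4 (iv) for `(ℙ¹_ℚ, ω_P(C) ≅ 𝒪(1))` = Northcott's theorem, DISCHARGED**: for every
`d` and `C`, the points of `U_P(Q̄)^{≤d}` of height `≤ C` are finitely many (finitely many minimal
polynomials) — the named fact `northcott_UPle` holds (second, Mahler-measure proof, seat abc-iut-L3-t12; the first proof is `northcott_UPle_holds` above). "There are only finitely many algebraic numbers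
of bounded degree and bounded height." [cite: BombieriGubler2006, Thm 1.6.8] -/
theorem northcott_UPle_holds' : northcott_UPle := by
  intro d c
  classical
  -- Northcott for integer polynomials: degree ≤ d, Mahler measure ≤ exp(d · max(c, 0))
  set B : NNReal := ⟨Real.exp (d * max c 0), (Real.exp_pos _).le⟩ with hB
  have hfin := Polynomial.finite_mahlerMeasure_le d B
  -- the minimal polynomial as a function of the integer minimal polynomial
  set r : ℤ[X] → ℚ[X] := fun Q =>
    Q.map (Int.castRingHom ℚ) * C ((Q.map (Int.castRingHom ℚ)).leadingCoeff)⁻¹ with hr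
  refine (hfin.image r).subset ?_
  rintro _ ⟨P, ⟨hPd, hPC⟩, rfl⟩
  obtain ⟨Q, hQ, hd, hx⟩ := P.exists_irreducible_int_aeval_eq_zero
  refine ⟨Q, ⟨(P.natDegree_le_degree hQ hd hx).trans hPd.2, ?_⟩, ?_⟩
  swap
  · simp only [hr]
    exact (P.mpoly_eq_of_irreducible hQ hd hx).symm
  -- `M(Q) = exp(deg Q · ht P) ≤ exp(d · max(c, 0))`
  have hQC0 : Q.map (Int.castRingHom ℂ) ≠ 0 :=
    (Polynomial.map_ne_zero_iff (Int.castRingHom ℂ).injective_int).mpr hQ.ne_zero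
  have hM0 : 0 < (Q.map (Int.castRingHom ℂ)).mahlerMeasure := mahlerMeasure_pos_of_ne_zero hQC0
  have hht := P.ht_eq_log_mahlerMeasure_div hQ hd hx
  have hdR : (0 : ℝ) < Q.natDegree := by exact_mod_cast hd
  have hlog : Real.log (Q.map (Int.castRingHom ℂ)).mahlerMeasure = Q.natDegree * P.ht := by
    rw [hht]
    field_simp
  have hdeg : (Q.natDegree : ℝ) ≤ d := by
    exact_mod_cast (P.natDegree_le_degree hQ hd hx).trans hPd.2
  have hht0 : 0 ≤ P.ht := P.ht_nonneg
  have hhtC : P.ht ≤ max c 0 := hPC.trans (le_max_left c 0)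
  have hle : Real.log (Q.map (Int.castRingHom ℂ)).mahlerMeasure ≤ d * max c 0 := by
    rw [hlog]
    exact mul_le_mul hdeg hhtC hht0 (Nat.cast_nonneg d)
  show (Q.map (Int.castRingHom ℂ)).mahlerMeasure ≤ Real.exp (d * max c 0)
  calc (Q.map (Int.castRingHom ℂ)).mahlerMeasure
      = Real.exp (Real.log (Q.map (Int.castRingHom ℂ)).mahlerMeasure) := (Real.exp_log hM0).symm
    _ ≤ Real.exp (d * max c 0) := Real.exp_le_exp.mpr hle

end Literature.NumberTheory.DiophantineGeometry.GenEll

end
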